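import Mathlib.LinearAlgebra.BilinearForm.Properties
import Mathlib.LinearAlgebra.BilinearForm.IsometryEquiv
import Mathlib.LinearAlgebra.PerfectPairing.Basic
import Mathlib.LinearAlgebra.QuadraticForm.Signature
import Mathlib.Algebra.Module.Torsion.Basic
import Mathlib.Geometry.Manifold.ChartedSpace
import Mathlib.Analysis.InnerProductSpace.PiL2
import Literature.AlgebraicTopology.SingularHomology.PoincareDuality
import HarnessLib

-- provenance: harness21/H21/H21/Prelude/AlgTop/IntersectionForm.lean @ 32fb086 (interim HEAD d8f2665); M5 mechanical rewrite
/-!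
# The intersection form of a closed oriented manifold (trunk G04 AlgTop, item C11)

For a closed `ℤ`-oriented topological manifold `X` of dimension `n = k + k`
(`[CompactSpace X] [T2Space X] [ChartedSpace (EuclideanSpace ℝ (Fin n)) X]`,
`μ : HomologicalOrientation ℤ X n`) the *intersection form* is the `ℤ`-bilinear form
`Q_X : Hᵏ(X; ℤ)/T × Hᵏ(X; ℤ)/T → ℤ`, `([a], [b]) ↦ ⟨a ⌣ b, [X]⟩` on integral cohomology modulo
torsion. It is symmetric for `k` even, alternating for `k` odd, unimodular (Poincaré duality),
changes sign under orientation reversal, is natural under homeomorphisms, and its rank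
`b_k = b_k⁺ + b_k⁻` splits as the sum of the maximal ranks of positive / negative definite
sublattices. This file is the T-ALGTOP half of the notion `intersection_form`; the lattice
vocabulary (integer signature, parity, definiteness, `E₈`, `H`) belongs to T-4MAN and is stated
there generically for `{V} [AddCommGroup V] [Module ℤ V] (Q : LinearMap.BilinForm ℤ V)`, which
applies verbatim to `Literature.intersectionForm h μ`.

Sources: J. Milnor, D. Husemoller, *Symmetric Bilinear Forms*, Springer 1973, §II.1 and §V.1;
R. Gompf, A. Stipsicz, *4-Manifolds and Kirby Calculus*, AMS 1999, §1.2 (Def. 1.2.1ff.);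
A. Hatcher, *Algebraic Topology*, CUP 2002, §3.3, Prop. 3.38 and Cor. 3.39.

Mathlib (pinned) has no intersection form (searched `intersectionForm`, `intersection_form`,
`cupPairing`). Everything lattice-theoretic is taken from Mathlib and **not** redefined:
`LinearMap.BilinForm.IsSymm`, `LinearMap.BilinForm.IsAlt`
(`Mathlib/LinearAlgebra/BilinearForm/Properties.lean`), `LinearMap.IsPerfPair`
(`Mathlib/LinearAlgebra/PerfectPairing/Basic.lean`), `LinearMap.BilinForm.IsometryEquiv` /
`LinearMap.BilinForm.Equivalent` (`Mathlib/LinearAlgebra/BilinearForm/IsometryEquiv.lean`; no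
home-made isometry predicate), the root-level `sigPos` / `sigNeg`
(`Mathlib/LinearAlgebra/QuadraticForm/Signature.lean`, used over `ℤ` directly: maximal rank of a
positive / negative definite sublattice), `LinearMap.BilinMap.toQuadraticMap`, `Module.finrank`.
The integer `signature := sigPos - sigNeg` is *not* named here (T-4MAN, `z_lattice_invariants`).

## Design (ℤ-instance discipline, trunk outline §1)

No binder `[Module ℤ _]` appears in this file: `intersectionForm h μ` is obtained purely by
instantiating `R := ℤ` in `Literature.AlgebraicTopology.SingularHomology.cupPairingModTorsion`, whose carrier `freeCohomology R X k` is a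
bundled `ModuleCat R` object defined generically in `R`; at `R := ℤ` typeclass search finds
`ModuleCat.isModule` (see the sanity `example` below), so all generic `Module ℤ` consumers
elaborate. The degree bookkeeping is an explicit equation `h : k + k = n` (4-manifolds use
`h : 2 + 2 = 4`), avoiding `2 * k` arithmetic and casts. As in `Literature.Prelude.AlgTop.PoincareDuality`
the plain definition `intersectionForm` carries no manifold hypotheses (it makes sense for every
space, with `[X]` possibly the junk value `0`); the manifold hypotheses appear on the theorems.
`LinearMap.IsPerfPair` is a class, but unimodularity is stated as a *theorem* (from the named fact
`isPerfPair_cupPairingModTorsion`), never as an instance.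

For naturality we add the small generic API `Literature.freeCohomology.map f k`
(`f^*` on cohomology mod torsion; torsion is mapped to torsion by any linear map) and
`Literature.freeCohomology.mapEquiv e k` for a homeomorphism `e`.

## Main definitions

* `Literature.intersectionForm h μ : LinearMap.BilinForm ℤ ↥(freeCohomology ℤ X k)`.
* `Literature.freeCohomology.map f k`, `Literature.freeCohomology.mapEquiv e k` (functoriality mod torsion).

## Main statements

* `Literature.AlgebraicTopology.SingularHomology.isSymm_intersectionForm` (`k` even), `Literature.AlgebraicTopology.SingularHomology.isAlt_intersectionForm` (`k` odd) — proved from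
  graded commutativity `Literature.AlgebraicTopology.SingularHomology.cupPairingModTorsion_flip`, given the named fact
  `hc : cupProduct_gradedComm ℤ X` (`CupProduct.lean`).
* `Literature.AlgebraicTopology.SingularHomology.isPerfPair_intersectionForm` (unimodularity; Hatcher Cor. 3.39) — from the named fact
  `Literature.AlgebraicTopology.SingularHomology.isPerfPair_cupPairingModTorsion` taken as a hypothesis.
* `Literature.AlgebraicTopology.SingularHomology.intersectionForm_neg` (`Q_{-X} = -Q_X`) — proved from the named fact
  `HomologicalOrientation.fundamentalClass_neg` taken as a hypothesis.
* `Literature.AlgebraicTopology.SingularHomology.finrank_freeCohomology_eq_bettiNumber` (`rank Hᵏ(X;ℤ)/T = b_k(X; ℚ)`; named fact, D-0014).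
* `Literature.AlgebraicTopology.SingularHomology.intersectionForm_comap_mk_mk`, `Literature.AlgebraicTopology.SingularHomology.equivalent_intersectionForm_comap` (homeomorphism
  invariance) — proved from the named fact `HomologicalOrientation.fundamentalClass_comap` taken
  as a hypothesis.
* `Literature.AlgebraicTopology.SingularHomology.sigPos_add_sigNeg_intersectionForm` (`b_k = b_k⁺ + b_k⁻`; Milnor–Husemoller §II.1; named
  fact, D-0014).
-/

noncomputable section

open CategoryTheory Topology nonZeroDivisors

universe u v

namespace Literature.AlgebraicTopology.SingularHomology

/-! ### Functoriality of cohomology modulo torsion -/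

namespace freeCohomology

variable {R : Type v} [CommRing R]
variable {X : Type u} [TopologicalSpace X] {Y : Type u} [TopologicalSpace Y] {k : ℕ}

/-- A linear map sends torsion elements to torsion elements: `torsion R V ≤ f⁻¹(torsion R W)`
(Bourbaki, *Algèbre* II, §7, no. 10; immediate from `f (r • x) = r • f x`). Auxiliary for
`freeCohomology.map`. [folklore] -/
lemma torsion_le_comap_torsion {V W : Type*} [AddCommGroup V] [Module R V] [AddCommGroup W]
    [Module R W] (f : V →ₗ[R] W) :
    Submodule.torsion R V ≤ (Submodule.torsion R W).comap f := by
  intro x hx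
  obtain ⟨r, hrx⟩ := (Submodule.mem_torsion_iff x).mp hx
  refine (Submodule.mem_torsion_iff _).mpr ⟨r, ?_⟩
  change (r : R) • f x = 0
  rw [← map_smul]
  exact (congrArg f hrx).trans (map_zero f)

/-- The induced map `f^* : Hᵏ(Y; R)/T → Hᵏ(X; R)/T` on cohomology modulo torsion of a continuous
map `f : X → Y` (Hatcher 2002, §3.1 "Induced homomorphisms" and §3.3, p. 250): the map induced on
quotients by `singularCohomology.map R R f k`, which preserves torsion. [cite: Hatcher2002, §3.1 "Induced homomorphisms" and §3.3  p] -/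
def map (f : C(X, Y)) (k : ℕ) : freeCohomology R Y k →ₗ[R] freeCohomology R X k :=
  (Submodule.torsion R ↥(singularCohomology R R Y k)).mapQ
    (Submodule.torsion R ↥(singularCohomology R R X k)) (singularCohomology.map R R f k).hom
    (torsion_le_comap_torsion _)

/-- `f^* [a] = [f^* a]` on cohomology modulo torsion (Hatcher 2002, §3.1). [cite: Hatcher2002, §3.1] -/
@[simp]
lemma map_mk (f : C(X, Y)) (a : singularCohomology R R Y k) :
    map f k (mk a) = mk (singularCohomology.map R R f k a) :=
  rfl

/-- `𝟙^* = 𝟙` on cohomology modulo torsion (Hatcher 2002, §3.1). [cite: Hatcher2002, §3.1] -/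
@[simp]
lemma map_id (k : ℕ) : map (R := R) (ContinuousMap.id X) k = LinearMap.id := by
  ext x
  induction x using freeCohomology.induction_on with
  | h a => rw [map_mk, singularCohomology.map_id]; rfl

/-- `(g ∘ f)^* = f^* ∘ g^*` on cohomology modulo torsion (Hatcher 2002, §3.1). [cite: Hatcher2002, §3.1] -/
lemma map_comp {Z : Type u} [TopologicalSpace Z] (f : C(X, Y)) (g : C(Y, Z)) (k : ℕ) :
    map (R := R) (g.comp f) k = (map f k).comp (map g k) := by
  ext x
  induction x using freeCohomology.induction_on with
  | h a => rw [map_mk, singularCohomology.map_comp]; rfl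

/-- A homeomorphism `e : X ≃ₜ Y` induces a linear isomorphism `Hᵏ(Y; R)/T ≃ₗ[R] Hᵏ(X; R)/T`,
`e^*` with inverse `(e⁻¹)^*` (Hatcher 2002, §3.1). [cite: Hatcher2002, §3.1] -/
def mapEquiv (e : X ≃ₜ Y) (k : ℕ) : freeCohomology R Y k ≃ₗ[R] freeCohomology R X k :=
  LinearEquiv.ofLinear (map (e : C(X, Y)) k) (map (e.symm : C(Y, X)) k)
    (by
      rw [← map_comp]
      exact (congrArg (map (R := R) · k) (by ext x; exact e.symm_apply_apply x)).trans (map_id k))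
    (by
      rw [← map_comp]
      exact (congrArg (map (R := R) · k) (by ext x; exact e.apply_symm_apply x)).trans (map_id k))

/-- `freeCohomology.mapEquiv e k` is `e^*` (Hatcher 2002, §3.1). [cite: Hatcher2002, §3.1] -/
@[simp]
lemma mapEquiv_apply (e : X ≃ₜ Y) (x : freeCohomology R Y k) :
    mapEquiv e k x = map (e : C(X, Y)) k x :=
  rfl

end freeCohomology

/-! ### The intersection form -/

section IntersectionForm

variable {X : Type u} [TopologicalSpace X] {Y : Type u} [TopologicalSpace Y] {k n : ℕ}

/-- The **intersection form** of a `ℤ`-oriented space of formal dimension `n = k + k`: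
the `ℤ`-bilinear form `Q_X : Hᵏ(X; ℤ)/T × Hᵏ(X; ℤ)/T → ℤ`, `([a], [b]) ↦ ⟨a ⌣ b, [X]⟩`, on
integral cohomology modulo torsion (Milnor–Husemoller 1973, §II.1 and §V.1; Gompf–Stipsicz 1999,
§1.2, Def. 1.2.1 in its cohomological form; Hatcher 2002, §3.3, Cor. 3.39). It is
`Literature.AlgebraicTopology.SingularHomology.cupPairingModTorsion` at `R := ℤ`, `p = q = k`. Defined for every space; meaningful for `X` a
closed topological `n`-manifold (`[CompactSpace X] [T2Space X]
[ChartedSpace (EuclideanSpace ℝ (Fin n)) X]`), otherwise `[X]` may be the junk value `0`.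
Relies on: `bilinear_apply_eq_zero_of_mem_torsion`, `d_cochainCup`, `d_capChain` (all proved),
via `cupPairingModTorsion`. [cite: MilnorHusemoller1973, §II.1 and §V.1] -/
def intersectionForm (h : k + k = n) (μ : HomologicalOrientation ℤ X n) :
    LinearMap.BilinForm ℤ ↥(freeCohomology ℤ X k) :=
  cupPairingModTorsion (R := ℤ) μ h

/-- `Q_X [a] [b] = ⟨a ⌣ b, [X]⟩` (Milnor–Husemoller 1973, §V.1; Hatcher 2002, §3.3, p. 250). [cite: MilnorHusemoller1973, §V.1] -/
@[simp]
lemma intersectionForm_mk_mk (h : k + k = n) (μ : HomologicalOrientation ℤ X n)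
    (a b : singularCohomology ℤ ℤ X k) :
    intersectionForm h μ (freeCohomology.mk a) (freeCohomology.mk b) = cupPairing μ h a b :=
  rfl

/-- Sanity check (ℤ-instance discipline, trunk outline §1(iii)): the `Module ℤ` instance found on
the carrier of `freeCohomology ℤ X k` is `ModuleCat.isModule`. -/
example : (inferInstance : Module ℤ ↥(freeCohomology ℤ X k)) = (freeCohomology ℤ X k).isModule :=
  rfl

/-- The intersection form is graded-symmetric: `Q_X y x = (-1)^{k·k} Q_X x y`
(Hatcher 2002, §3.3, p. 250; from `cupPairingModTorsion_flip` and the named fact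
`hc : cupProduct_gradedComm ℤ X`). [cite: Hatcher2002, §3.3  p. 250] -/
lemma intersectionForm_flip (hc : cupProduct_gradedComm ℤ X) (h : k + k = n)
    (μ : HomologicalOrientation ℤ X n) :
    (intersectionForm h μ).flip = ((-1 : ℤ) ^ (k * k)) • intersectionForm h μ :=
  cupPairingModTorsion_flip hc μ h h

/-- For `k` even (e.g. `4`-manifolds, `k = 2`) the intersection form on `Hᵏ(X²ᵏ; ℤ)/T` is
symmetric (Milnor–Husemoller 1973, §V.1; Gompf–Stipsicz 1999, §1.2; Hatcher 2002, §3.3,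
p. 250). Needs the named fact `hc : cupProduct_gradedComm ℤ X`. [cite: MilnorHusemoller1973, §V.1] -/
theorem isSymm_intersectionForm (hc : cupProduct_gradedComm ℤ X) (hk : Even k) (h : k + k = n)
    (μ : HomologicalOrientation ℤ X n) : (intersectionForm h μ).IsSymm := by
  rw [LinearMap.BilinForm.isSymm_def]
  intro x y
  have hflip := intersectionForm_flip hc h μ
  rw [Even.neg_one_pow (hk.mul_right k), one_smul] at hflip
  simpa using congrArg (fun B ↦ B y x) hflip

/-- For `k` odd the intersection form on `Hᵏ(X²ᵏ; ℤ)/T` is alternating (skew-symmetric),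
`Q_X x x = 0` (Milnor–Husemoller 1973, §V.1; Hatcher 2002, §3.3, p. 250: for `k` odd
`Q(x, x) = -Q(x, x)`, and `ℤ` has no `2`-torsion). Needs the named fact
`hc : cupProduct_gradedComm ℤ X`. [cite: MilnorHusemoller1973, §V.1] -/
theorem isAlt_intersectionForm (hc : cupProduct_gradedComm ℤ X) (hk : Odd k) (h : k + k = n)
    (μ : HomologicalOrientation ℤ X n) : (intersectionForm h μ).IsAlt := by
  intro x
  have hflip := intersectionForm_flip hc h μ
  rw [Odd.neg_one_pow (hk.mul hk)] at hflip
  have hx : intersectionForm h μ x x = -intersectionForm h μ x x := by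
    simpa using congrArg (fun B ↦ B x x) hflip
  omega

/-- **Unimodularity.** For a closed `ℤ`-oriented topological `2k`-manifold the intersection form
on `Hᵏ(X; ℤ)/T` is a perfect pairing over `ℤ` (both adjoints `Hᵏ/T → Hom(Hᵏ/T, ℤ)` are
bijective, i.e. the form is unimodular) (Hatcher 2002, §3.3, Cor. 3.39; Milnor–Husemoller 1973,
§V.1, Thm. 1.1; Gompf–Stipsicz 1999, §1.2). Stated as a theorem: `LinearMap.IsPerfPair` is a
class, but no instance is registered. The Poincaré-duality input is the named fact
`hP : isPerfPair_cupPairingModTorsion μ h` (`PoincareDuality.lean`, D-0014), of which this is the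
specialisation `R := ℤ`, `p = q = k`. [cite: Hatcher2002, §3.3  Cor. 3.39] -/
theorem isPerfPair_intersectionForm [CompactSpace X] [T2Space X]
    [ChartedSpace (EuclideanSpace ℝ (Fin n)) X] (h : k + k = n)
    (μ : HomologicalOrientation ℤ X n) (hP : isPerfPair_cupPairingModTorsion μ h) :
    (intersectionForm h μ).IsPerfPair :=
  hP

/-- **Orientation reversal.** Reversing the orientation negates the intersection form,
`Q_{-X} = -Q_X`, since `[X]_{-μ} = -[X]_μ` (Milnor–Husemoller 1973, §V.1; Gompf–Stipsicz 1999,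
§1.2, remark after Def. 1.2.1). Needs the named fact
`hneg : HomologicalOrientation.fundamentalClass_neg` (`FundamentalClass.lean`, at `R := ℤ`). [cite: MilnorHusemoller1973, §V.1] -/
theorem intersectionForm_neg [CompactSpace X] [T2Space X]
    [ChartedSpace (EuclideanSpace ℝ (Fin n)) X]
    (hneg : HomologicalOrientation.fundamentalClass_neg (R := ℤ) (X := X) (n := n))
    (h : k + k = n) (μ : HomologicalOrientation ℤ X n) :
    intersectionForm h (-μ) = -intersectionForm h μ := by
  ext x y
  induction x using freeCohomology.induction_on with
  | h a =>
    induction y using freeCohomology.induction_on with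
    | h b =>
      simp only [LinearMap.neg_apply, intersectionForm_mk_mk, cupPairing_apply, hneg μ, map_neg]

/-- **Rank.** For a closed topological manifold, the rank of `Hᵏ(X; ℤ)/T` is the `k`-th rational
Betti number `b_k(X; ℚ) = dim_ℚ H_k(X; ℚ)` (universal coefficients: `Hᵏ(X; ℤ)/T ≅ Hom(H_k(X; ℤ), ℤ)/0`
is free of rank `rank H_k(X; ℤ) = dim_ℚ H_k(X; ℚ)`; Hatcher 2002, §3.1, Cor. 3.3 and §3.3, p. 250;
Milnor–Husemoller 1973, §V.1). Named fact (D-0014), not proved here. [cite: Hatcher2002, §3.1  Cor. 3.3 and §3.3  p. 250] -/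
def finrank_freeCohomology_eq_bettiNumber [CompactSpace X] [T2Space X]
    [ChartedSpace (EuclideanSpace ℝ (Fin n)) X] (k : ℕ) : Prop :=
  Module.finrank ℤ ↥(freeCohomology ℤ X k) = bettiNumber ℚ X k

/-- **Naturality under homeomorphisms.** For `e : Y ≃ₜ X` and the transported orientation
`μ.comap e`, `Q_Y [e^* a] [e^* b] = Q_X [a] [b]`: indeed
`⟨e^*a ⌣ e^*b, [Y]⟩ = ⟨e^*(a ⌣ b), (e⁻¹)_*[X]⟩ = ⟨a ⌣ b, e_*(e⁻¹)_*[X]⟩` (Milnor–Husemoller 1973,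
§V.1; Gompf–Stipsicz 1999, §1.2: the intersection form is a homeomorphism invariant). Needs the
named fact `hcomap : HomologicalOrientation.fundamentalClass_comap` (`FundamentalClass.lean`, at
`R := ℤ`). [cite: MilnorHusemoller1973, §V.1] -/
theorem intersectionForm_comap_mk_mk [CompactSpace X] [T2Space X]
    [ChartedSpace (EuclideanSpace ℝ (Fin n)) X]
    (hcomap : HomologicalOrientation.fundamentalClass_comap (R := ℤ) (X := X) (Y := Y) (n := n))
    (h : k + k = n) (μ : HomologicalOrientation ℤ X n) (e : Y ≃ₜ X)
    (a b : singularCohomology ℤ ℤ X k) :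
    intersectionForm h (μ.comap e) (freeCohomology.mk (singularCohomology.map ℤ ℤ (e : C(Y, X)) k a))
        (freeCohomology.mk (singularCohomology.map ℤ ℤ (e : C(Y, X)) k b)) =
      intersectionForm h μ (freeCohomology.mk a) (freeCohomology.mk b) := by
  rw [intersectionForm_mk_mk, intersectionForm_mk_mk, cupPairing_apply, cupPairing_apply,
    ← cupProduct_map, kroneckerPairing_map, hcomap μ e,
    ← singularHomology.mapIso_hom, ← ModuleCat.comp_apply, Iso.inv_hom_id, ModuleCat.id_apply]

/-- The isometry `(Hᵏ(X; ℤ)/T, Q_X) ≃ (Hᵏ(Y; ℤ)/T, Q_Y)` induced by a homeomorphism `e : Y ≃ₜ X`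
with `Y` carrying the transported orientation `μ.comap e`; the underlying linear equivalence is
`e^* = freeCohomology.mapEquiv e k` (Milnor–Husemoller 1973, §V.1; Gompf–Stipsicz 1999, §1.2).
Needs the named fact `hcomap : HomologicalOrientation.fundamentalClass_comap` (at `R := ℤ`). [cite: MilnorHusemoller1973, §V.1] -/
def intersectionFormIsometryEquivComap [CompactSpace X] [T2Space X]
    [ChartedSpace (EuclideanSpace ℝ (Fin n)) X]
    (hcomap : HomologicalOrientation.fundamentalClass_comap (R := ℤ) (X := X) (Y := Y) (n := n))
    (h : k + k = n) (μ : HomologicalOrientation ℤ X n) (e : Y ≃ₜ X) :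
    (intersectionForm h μ).IsometryEquiv (intersectionForm h (μ.comap e)) where
  toLinearEquiv := freeCohomology.mapEquiv e k
  map_app' x y := by
    induction x using freeCohomology.induction_on with
    | h a =>
      induction y using freeCohomology.induction_on with
      | h b =>
        change intersectionForm h (μ.comap e) (freeCohomology.mapEquiv e k (freeCohomology.mk a))
          (freeCohomology.mapEquiv e k (freeCohomology.mk b)) = _
        rw [freeCohomology.mapEquiv_apply, freeCohomology.mapEquiv_apply, freeCohomology.map_mk,
          freeCohomology.map_mk, intersectionForm_comap_mk_mk hcomap]

/-- **Homeomorphism invariance.** The intersection form of `Y` with the orientation transported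
along a homeomorphism `e : Y ≃ₜ X` is equivalent (isometric), in the sense of Mathlib's
`LinearMap.BilinForm.Equivalent`, to the intersection form of `X` (Milnor–Husemoller 1973, §V.1;
Gompf–Stipsicz 1999, §1.2: "the intersection form is an invariant of the oriented homeomorphism
type"). Needs the named fact `hcomap : HomologicalOrientation.fundamentalClass_comap` (at
`R := ℤ`). [cite: MilnorHusemoller1973, §V.1] -/
theorem equivalent_intersectionForm_comap [CompactSpace X] [T2Space X]
    [ChartedSpace (EuclideanSpace ℝ (Fin n)) X]
    (hcomap : HomologicalOrientation.fundamentalClass_comap (R := ℤ) (X := X) (Y := Y) (n := n))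
    (h : k + k = n) (μ : HomologicalOrientation ℤ X n) (e : Y ≃ₜ X) :
    (intersectionForm h (μ.comap e)).Equivalent (intersectionForm h μ) :=
  ⟨(intersectionFormIsometryEquivComap hcomap h μ e).symm⟩

/-- **Signature split `b_k = b_k⁺ + b_k⁻`.** For a closed `ℤ`-oriented `2k`-manifold with `k`
even, the maximal rank of a positive definite sublattice plus the maximal rank of a negative
definite sublattice of `(Hᵏ(X; ℤ)/T, Q_X)` equals the rank `b_k`; this expresses nondegeneracy of
the symmetric form `Q_X` over `ℝ` (Sylvester) transported to `ℤ` (Milnor–Husemoller 1973, §II.1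
and §V.1; Gompf–Stipsicz 1999, §1.2, `b₂ = b₂⁺ + b₂⁻`). Uses Mathlib's root-level `sigPos`,
`sigNeg` over `ℤ`; the integer signature `sigPos - sigNeg` is named in T-4MAN. Named fact
(D-0014), not proved here; the parity witness `hk` is a parameter so that the fact is only ever
assumed for symmetric `Q_X`. [cite: MilnorHusemoller1973, §II.1 and §V.1] -/
def sigPos_add_sigNeg_intersectionForm [CompactSpace X] [T2Space X]
    [ChartedSpace (EuclideanSpace ℝ (Fin n)) X] (_hk : Even k) (h : k + k = n)
    (μ : HomologicalOrientation ℤ X n) : Prop :=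
  sigPos (intersectionForm h μ).toQuadraticMap + sigNeg (intersectionForm h μ).toQuadraticMap =
    Module.finrank ℤ ↥(freeCohomology ℤ X k)

end IntersectionForm

end Literature.AlgebraicTopology.SingularHomology
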